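/-
Fleet lead `ym-wcr-19609-p1` (seat prover-ym-wcr-19609-p1-g2-0), route `WeakCouplingRates`, crux `BulkDominatesColdBoxW`
(stmt-QuantumFields-19609), line `dlr-chessboard` (v6): the KERNEL BRIDGE T5 of the critic's STUB-PLAN rev 2 (CriticSketch2), in its exact signature.
-/
import Summits.QuantumFields.YangMills.Theorems.WeakCouplingRatesBulkDominatesColdBoxWKernelTransport
import Summits.QuantumFields.YangMills.Theorems.WeakCouplingRatesColdBoxForestGauge

/-!
# Crux `BulkDominatesColdBoxW`, expansion stubs: the kernel bridge `γ(·|ω) = γ(·|W)` for gauge-invariant observables local to the enlarged box,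
# `W = forestFix H (truncated gauge copy of ω)` — the configuration charted by `exists_datum_coords_energy_eventually`

T5 of the critic's STUB-PLAN rev 2 (evidence #34/#35, `CriticSketch2.integral_boxKernel_eq_of_gauge_trunc`), proved in EXACTLY that signature so the
assembler's `_explicit` theorems instantiate it by `exact`: for measurable gauge-invariant `X` with `X U = X U'` whenever `U = U'` on
`E = boxEdgesAt dirCorner (2H+3)`,
  `∫ X dγ(·|ω) = ∫ X dγ(·| forestFix H (glueWith E ((ω^g)|_E) 1))`.
Steps: the forest gauge fixing is a gauge transformation of the datum (`forestFix H V = (V)^{forestGauge H V}`, so B3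
`integral_ymSpecification_gaugeTransformZd` removes it: `integral_boxKernel_forestFix_eq`), then the weak-locality transport
`integral_boxKernel_eq_trunc_gauge_of_enlarged` (`…KernelTransport`).  Also the event form (`measureReal_boxKernel_eq_of_gauge_trunc`).
No new definition; standard axioms.  NOT a claim about the mass gap.
-/

set_option autoImplicit false

noncomputable section

open MeasureTheory Finset
open Literature.Probability.LatticeModels Literature.MathematicalPhysics.QuantumLattice
open Literature.MathematicalPhysics.QuantumFieldTheory Literature.MathematicalPhysics.QuantumFieldTheory.AxialGauge
open Literature.MathematicalPhysics.QuantumFieldTheory.LatticeMaxwell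

namespace Summit.QuantumFields.YangMills.Theorems.WeakCouplingRates

/-- **The forest gauge fixing of the datum does not change kernel means of gauge-invariant observables.** -/
theorem integral_boxKernel_forestFix_eq (β : ℝ) (H : ℕ) (V : LGConfig 4 (Matrix.specialUnitaryGroup (Fin 2) ℂ))
    {X : LGConfig 4 (Matrix.specialUnitaryGroup (Fin 2) ℂ) → ℝ} (hXm : Measurable X) (hXinv : IsZdGaugeInvariant X) :
    ∫ U, X U ∂(boxKernel β H (forestFix H V)) = ∫ U, X U ∂(boxKernel β H V) := by
  unfold boxKernel forestFix
  exact integral_ymSpecification_gaugeTransformZd (fundamentalRep (Fin 2)) (continuous_fundamentalRep (Fin 2)) β _ hXm hXinv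
    (forestGauge H V) V

/-- Locality on the enlarged box in the `U = U'  on E` form implies the glued (weak-locality) form used by `…KernelTransport`. -/
theorem glueWith_loc_of_enlarged_loc {H : ℕ} {X : LGConfig 4 (Matrix.specialUnitaryGroup (Fin 2) ℂ) → ℝ}
    (hXloc : ∀ U U' : LGConfig 4 (Matrix.specialUnitaryGroup (Fin 2) ℂ),
      (∀ e ∈ boxEdgesAt dirCorner (2 * H + 3), U e = U' e) → X U = X U')
    (ζ : ↥(boxEdges 4 (2 * H + 1)) → Matrix.specialUnitaryGroup (Fin 2) ℂ) (η η' : LGConfig 4 (Matrix.specialUnitaryGroup (Fin 2) ℂ))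
    (hη : ∀ e ∈ boxEdgesAt dirCorner (2 * H + 3), η e = η' e) :
    X (glueWith (boxEdges 4 (2 * H + 1)) ζ η) = X (glueWith (boxEdges 4 (2 * H + 1)) ζ η') := by
  refine hXloc _ _ fun e he => ?_
  by_cases heΛ : e ∈ boxEdges 4 (2 * H + 1)
  · rw [glueWith_apply_mem _ _ _ heΛ, glueWith_apply_mem _ _ _ heΛ]
  · rw [glueWith_apply_not_mem _ _ _ heΛ, glueWith_apply_not_mem _ _ _ heΛ, hη e he]

/-- **T5 — the kernel bridge** (exact signature of `CriticSketch2.integral_boxKernel_eq_of_gauge_trunc`): kernel means of measurable gauge-invariant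
observables local to the enlarged box are the same at the crude-good datum `ω` and at the forest-fixed truncated gauge copy
`forestFix H (glueWith E ((ω^g)|_E) 1)`. -/
theorem integral_boxKernel_eq_of_gauge_trunc (β : ℝ) (H : ℕ) (ω : LGConfig 4 (Matrix.specialUnitaryGroup (Fin 2) ℂ))
    (g : Site 4 → Matrix.specialUnitaryGroup (Fin 2) ℂ)
    {X : LGConfig 4 (Matrix.specialUnitaryGroup (Fin 2) ℂ) → ℝ} (hXm : Measurable X) (hXinv : IsZdGaugeInvariant X)
    (hXloc : ∀ U U' : LGConfig 4 (Matrix.specialUnitaryGroup (Fin 2) ℂ),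
      (∀ e ∈ boxEdgesAt dirCorner (2 * H + 3), U e = U' e) → X U = X U') :
    ∫ U, X U ∂(boxKernel β H ω) =
      ∫ U, X U ∂(boxKernel β H
        (forestFix H (glueWith (boxEdgesAt dirCorner (2 * H + 3))
          (fun e' : ↥(boxEdgesAt dirCorner (2 * H + 3)) => gaugeTransformZd g ω e'.1) (fun _ => 1)))) := by
  rw [integral_boxKernel_forestFix_eq β H _ hXm hXinv]
  exact integral_boxKernel_eq_trunc_gauge_of_enlarged β H ω g hXm hXinv (fun ζ η η' hη => glueWith_loc_of_enlarged_loc hXloc ζ η η' hη)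

/-- **T5, event form**: probabilities of measurable gauge-invariant events local to the enlarged box (e.g. the collar large-field event). -/
theorem measureReal_boxKernel_eq_of_gauge_trunc (β : ℝ) (H : ℕ) (ω : LGConfig 4 (Matrix.specialUnitaryGroup (Fin 2) ℂ))
    (g : Site 4 → Matrix.specialUnitaryGroup (Fin 2) ℂ) {s : Set (LGConfig 4 (Matrix.specialUnitaryGroup (Fin 2) ℂ))}
    (hs : MeasurableSet s) (hsinv : ∀ (g' : Site 4 → Matrix.specialUnitaryGroup (Fin 2) ℂ) U, gaugeTransformZd g' U ∈ s ↔ U ∈ s)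
    (hsloc : ∀ U U' : LGConfig 4 (Matrix.specialUnitaryGroup (Fin 2) ℂ),
      (∀ e ∈ boxEdgesAt dirCorner (2 * H + 3), U e = U' e) → (U ∈ s ↔ U' ∈ s)) :
    (boxKernel β H ω).real s =
      (boxKernel β H (forestFix H (glueWith (boxEdgesAt dirCorner (2 * H + 3))
        (fun e' : ↥(boxEdgesAt dirCorner (2 * H + 3)) => gaugeTransformZd g ω e'.1) (fun _ => 1)))).real s := by
  rw [← integral_indicator_one hs, ← integral_indicator_one hs]
  refine integral_boxKernel_eq_of_gauge_trunc β H ω g (measurable_const.indicator hs) ?_ ?_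
  · intro g' U
    by_cases hU : U ∈ s
    · rw [Set.indicator_of_mem hU, Set.indicator_of_mem ((hsinv g' U).2 hU)]; rfl
    · rw [Set.indicator_of_notMem hU, Set.indicator_of_notMem (fun h => hU ((hsinv g' U).1 h))]
  · intro U U' hUU'
    by_cases hU : U ∈ s
    · rw [Set.indicator_of_mem hU, Set.indicator_of_mem ((hsloc U U' hUU').1 hU)]; rfl
    · rw [Set.indicator_of_notMem hU, Set.indicator_of_notMem (fun h => hU ((hsloc U U' hUU').2 h))]

/-- **The collar large-field event under the bridge**: same kernel probability at `ω` and at the forest-fixed truncated gauge copy, so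
`boxKernel_largeField_rarity_crudeGood` / `boxKernel_real_coldGoodSet_compl_le` (stated at crude-good `ω`) apply to the charted `W`. -/
theorem measureReal_largeField_boxKernel_eq_of_gauge_trunc (β s : ℝ) (H : ℕ) (ω : LGConfig 4 (Matrix.specialUnitaryGroup (Fin 2) ℂ))
    (g : Site 4 → Matrix.specialUnitaryGroup (Fin 2) ℂ) :
    (boxKernel β H ω).real {U | ∃ p ∈ plaquettesTouching (boxEdges 4 (2 * H + 1)),
        s ≤ (2 : ℝ) - plaquetteObs (fundamentalRep (Fin 2)) p.1 p.2.1.1 p.2.1.2 U} =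
      (boxKernel β H (forestFix H (glueWith (boxEdgesAt dirCorner (2 * H + 3))
        (fun e' : ↥(boxEdgesAt dirCorner (2 * H + 3)) => gaugeTransformZd g ω e'.1) (fun _ => 1)))).real
        {U | ∃ p ∈ plaquettesTouching (boxEdges 4 (2 * H + 1)),
          s ≤ (2 : ℝ) - plaquetteObs (fundamentalRep (Fin 2)) p.1 p.2.1.1 p.2.1.2 U} := by
  refine measureReal_boxKernel_eq_of_gauge_trunc β H ω g (measurableSet_exists_plaqCost_ge _ s) ?_ ?_
  · intro g' U
    simp only [Set.mem_setOf_eq, isZdGaugeInvariant_plaquetteObs (fundamentalRep (Fin 2)) _ _ _ g' U]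
  · intro U U' hUU'
    have hkey : ∀ p ∈ plaquettesTouching (boxEdges 4 (2 * H + 1)),
        plaquetteObs (fundamentalRep (Fin 2)) p.1 p.2.1.1 p.2.1.2 U = plaquetteObs (fundamentalRep (Fin 2)) p.1 p.2.1.1 p.2.1.2 U' := by
      intro p hp
      refine plaquetteObs_congr_links (fundamentalRep (Fin 2)) p.1 p.2.1.1 p.2.1.2 ?_ ?_ ?_ ?_ <;>
        apply hUU' <;> apply plaquetteEdges_subset_enlarged hp <;> simp [plaquetteEdges]
    simp only [Set.mem_setOf_eq]
    constructor
    · rintro ⟨p, hp, h⟩; exact ⟨p, hp, by rwa [← hkey p hp]⟩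
    · rintro ⟨p, hp, h⟩; exact ⟨p, hp, by rwa [hkey p hp]⟩

end Summit.QuantumFields.YangMills.Theorems.WeakCouplingRates

end
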